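import Summits.QuantumFields.BalabanUV.Beta.D1BFx.PackedStraightColumnMixedMass
import Summits.QuantumFields.BalabanUV.Beta.D1BFx.GhostWordFamilies
import Summits.QuantumFields.BalabanUV.Beta.SymSecondOrderTablesAn1

/-!
# `BalabanUV.Beta.D1BFx.StraightPinRestRow` — road «BF-x» for binder row D1, slot (K), PART 24 HEAD «TWO PINS», the HEAD skeleton's ROW (rest)
# (`ChartDefectHead.abs_secondMoment_chartDefect_le_of_rows`, OWNER d1-p2 g25 INTENT-2 l.53800: «(rest) `½·tadpole G₀ ((W2SymOfK K₀ … − vertex2OfK K₀ S₂⁰) μ₀ 0 ν₀ z₀)`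
# = `½·tadpole G₀` of the STRAIGHT mixed pair (`ChartDefectTwoPinsRest` (i)) — gan24-leaf-05 g61's (M-b) `mass_blk_mixOfK_K₀_le` currency»), «K0-REST-ROW»:
# **THE (rest) ROW IN `Decay510` ∕ (1.22) CURRENCY FROM THE (M-b) MASS OF THE STRAIGHT MIXED PAIR — `|½·tadpole G (mixOfK K₀ n M₂ μ 0 ν z + mixOfK K₀ n M₂ ν z μ 0)| ≤
# ½·S·(8·C^{mix}_{K₀})·e^{−r|z|₁}` for ANY leg `G` with `Bdd G S`, hence `AbsMoment₂` and `|secondMoment| ≤ ½·S·(8·C^{mix}_{K₀})·Σ'|x|₁²e^{−r|x|₁}` — NET `n⁻⁹ × S ×` the mixed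
# table's localisation constant, every factor DISPLAYED; at the record the table letter is an1's (`biLoc_symMixFFAt`), the leg letter `Bdd G₀ S` stays DISPLAYED**

HONEST DEPENDENCY (cell records, verbatim): «continuum YM on T⁴ ⇐ BetaPertH ∧ nine spine estimates (0/9 proved); BetaPertH ⇐ (D1) ∧ (D4) ∧
CAP+tail; G-an2-4 gates asym, D1 and NE2/3/4.»  HONEST FRAMING (cell contract, verbatim): «discharging `BetaPertH` makes Bałaban's UV stability
UNCONDITIONAL — a real constructive-QFT result; it is NOT the continuum limit and NOT the Clay problem.»  THIS MODULE DISCHARGES NOTHING of the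
wall: [folklore] `ℓ¹` ∕ (1.22) read-out bookkeeping BY NAME over LANDED objects (g61 C′ `PackedStraightColumnMixedMass.mass_blk_mixOfK_K₀_le_of_locStencilFM` ∕
`plainMass_blk_add_le`; d1-leaf-04's `GhostWordFamilies.decay510_tadpoleWord_of_mass`; lit `DecimatedMomentSummable.absMoment₂_of_decay510`, `B12Sec2to5.
secondMoment_abs_le_of_decay510`; an1's `SymAveragingMixedJetTables.biLoc_symMixFFAt`, lit `BalabanStepW2.locStencilFM_M2Of`).  No definition, no `def … : Prop`, nothing cited,
0 sorry.  The LEG letter `Bdd G S` (sup entry of the road kernel — in the tree only existential for `G₀ = coDressKBmAt ρ_c n K₀`) and the multiplier envelope `hΦ` (the SHAPE of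
d4-p3's `exists_wΦ_decay`) are DISPLAYED hypotheses; the table letter is DISPLAYED in §2–§3 and an1's in §4.  An INTERMEDIATE per-word letter (an2 R-D1-g45-4 (3)): it prices
ONE displayed row of the HEAD modulo those letters, NOT the HEAD, and asserts nothing about `n`-uniformity of `S`; 0 root-level binders of row D1 discharged (hW ∕ hR-sockets ∕
hSX-socket ∕ D1Tel ∕ D1Rep = 0); (J1) ONE OPEN ROW (eight displayed rows); (K) NOT closed; NOT D1, NEVER «G-an2-4 closed», NOT `BetaPertH`, NOT continuum, NOT Clay.

ABSOLUTE RULE (cell charter, verbatim): «No internally-minted statement may enter as a cited fact. Every hypothesis is either kernel-proved in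
this package or a verbatim quotation of a PUBLISHED theorem with page reference. The manuscript(s) under audit are NOT citable for their own
disputed steps — they are the thing under adjudication; programme-internal (2001/route/tribunal) claims are never citable.»

WHY.  The HEAD's row (rest) is the kernel `Wrest μ₀ ν₀ z₀ = ½·tadpole G₀ ((W2SymOfK K₀ n S♭ M⁰ S₂⁰ M₂⁰ − vertex2OfK K₀ n S₂⁰) μ₀ 0 ν₀ z₀)`, which `ChartDefectTwoPinsRest.
tadpole_rest_record_eq` rewrites to `½·tadpole G₀ (mixOfK K₀ n M₂⁰ μ₀ 0 ν₀ z₀ + mixOfK K₀ n M₂⁰ ν₀ z₀ μ₀ 0)`; its binders in the HEAD are `hArest : ∀ a e, AbsMoment₂ (Wrest a e)` and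
`hBrest : |secondMoment Wrest μ ν| ≤ Crest`.  A tadpole against a BOUNDED leg is at most the leg's sup times the table's full `ℓ¹` mass (`decay510_tadpoleWord_of_mass`), and that
mass is this lineage's g61 (M-b) letter summed over the four blocks of the packed fibre — so the row closes in `Decay510` currency with constant `½·S·8·C^{mix}_{K₀}` (two words ×
four blocks), `C^{mix}_{K₀} = (n⁵)⁻¹·(n⁵)⁻¹·(n³)⁻¹·(…)·n⁴·(table)` = NET `n⁻⁹ ×` table, and COARSE rate `r = min (min(κ′,κ₀)∕8) (δ∕2)` — n-free when the table's rate is.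

CONTENT (`K₀ := KInvStep 3 n 0`; `C^{mix}_{K₀}(C, δ)` := g61 C′'s displayed constant of `mass_blk_mixOfK_K₀_le_of_locStencilFM`, written out; `r := min (min (κ′) κ₀ ∕ 8) (δ ∕ 2)`,
`κ′ := kappa163 4 ∕ 4`).
* §1 **`fibreMass_eq_sum_blk`**, **`fibreMass_le_of_blk`** (the packed fibre's full `ℓ¹` mass is the sum of the four block masses).
* §2 **`fibreMass_restPair_K₀_le`** (`Summable` ∧ `Σ'_q Σ_{g a} |(mixOfK K₀ n M₂ μ y ν y′ + mixOfK K₀ n M₂ ν y′ μ y) q g a| ≤ 8·C^{mix}_{K₀}·e^{−r|y′ − y|₁}`).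
* §3 **`decay510_restWord_K₀`** (`Bdd G S`, `0 ≤ S` ⟹ `Decay510 (z ↦ ½·tadpole G (…μ 0 ν z + …ν z μ 0)) (½·(S·(8·C^{mix}_{K₀}))) r`), **`restRow_K₀`** (the HEAD's binder shapes:
  `∀ a e, AbsMoment₂ …` ∧ `|secondMoment (a e z ↦ …) μ ν| ≤ ½·(S·(8·C^{mix}_{K₀}))·Σ'_x |x|₁² e^{−r|x|₁}`).
* §4 **`restRow_record`**: `M₂ := M2Of 3 n (symTablesAn1S2 3 n cΛ).mixFF 0` with an1's every-rate letter (`C := |wM2 3 n 0|·symMixAbs ρ_c n·e^{24nδ}`, any `0 < δ`), modulo `Bdd G S` and `hΦ`.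
* §5 THE TABLE's COUNT FREE (R-T's reading): **`fibreMass_restPair_K₀_le_of_blockSlotTotal`**, **`restRow_K₀_of_blockSlotTotal`** (g61 C′ `mass_blk_mixOfK_K₀_le` — the table author's
  fine-block × coarse-slot totals `T j i` at coarse rate `θ` replace the `Zl`-route; the two straight columns pay exactly `n⁻¹³`).
NOT HERE (honest): the leg letter `Bdd G₀ S` with a displayed `S` (R-T ∕ the pricing seats); the identity (rest) = straight mixed pair (`ChartDefectTwoPinsRest` (i), the OWNER's);
the other seven rows; any claim that `S` or an1's `symMixAbs` is n-free.
Unit `b2b-balaban-gan24-formalise-leaf-05` (gen 62), G-an2-4 swarm leaf prover 05, road «BF-x» supplier; INTENT-4 «K0-REST-ROW» (journal [GAN24LEAF05-G62-INTENT-4]).  No existing file touched.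
-/

noncomputable section

open Finset
open scoped BigOperators
open Literature.MathematicalPhysics.QuantumFieldTheory
open Literature.MathematicalPhysics.QuantumFieldTheory.Balaban1983to89
open Literature.MathematicalPhysics.QuantumFieldTheory.Balaban1983to89.Beta
open B12Sec2to5 (l1 l1_nonneg Decay510 secondMoment_abs_le_of_decay510)
open DecimatedMomentSummable (AbsMoment₂ absMoment₂_of_decay510)
open B4ContourShift (supNorm)
open B5Hk163Strip (kappa163 kappa163_pos)
open B5Hk163Decay (MG163)
open B4TorusKernel (periodConst)
open ExpKernelCalculus (Site MKer Zl Zl_pos tadpole)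
open AveragingContoursRooted (ctr ctrOff ctrOff_mem_box)
open KernelSpecInstance (wΦ)
open KernelWard (Bdd)
open OneStepResolventKernel (Fib)
open OneStepKernelFamily (KInvStep)
open SecondOrderResponse (mixOfK LocStencilFM)
open BalabanStepW2 (M2Of wM2 locStencilFM_M2Of)
open Summit.QuantumFields.BalabanUV.Beta.SymAveragingMixedJetTables (symMixFFAt symMixAbs biLoc_symMixFFAt)
open Summit.QuantumFields.BalabanUV.Beta.SymSecondOrderTablesAn1 (symTablesAn1S2)
open Summit.QuantumFields.BalabanUV.Beta.D1BFx.PackedKernelSplit (blk)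
open Summit.QuantumFields.BalabanUV.Beta.D1BFx.PackedStraightColumnMixedMass (mass_blk_mixOfK_K₀_le mass_blk_mixOfK_K₀_le_of_locStencilFM plainMass_blk_add_le)
open Summit.QuantumFields.BalabanUV.Beta.D1BFx.GhostWordFamilies (decay510_tadpoleWord_of_mass)

namespace Summit.QuantumFields.BalabanUV.Beta.D1BFx.StraightPinRestRow

/-! ## §1 The packed fibre's full `ℓ¹` mass is the sum of the four block masses -/

/-- [folklore] Pointwise: `Σ_{g a : Fib 3} |W x z g a| = (tt + tf) + (ft + ff)` block masses (`Fintype.sum_sum_type` twice; `blk` by `rfl`). -/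
theorem fibreMass_eq_sum_blk (W : MKer 4 (Fib 3)) (q : Site 4 × Site 4) :
    ∑ g, ∑ a, |W q.1 q.2 g a|
      = ((∑ g, ∑ f, |blk W true true q.1 q.2 g f|) + ∑ g, ∑ f, |blk W true false q.1 q.2 g f|)
        + ((∑ g, ∑ f, |blk W false true q.1 q.2 g f|) + ∑ g, ∑ f, |blk W false false q.1 q.2 g f|) := by
  simp only [PackedKernelSplit.blk, PackedKernelSplit.inj]
  rw [Fintype.sum_sum_type]
  congr 1
  · rw [← Finset.sum_add_distrib]
    exact Finset.sum_congr rfl fun g _ => Fintype.sum_sum_type _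
  · rw [← Finset.sum_add_distrib]
    exact Finset.sum_congr rfl fun g _ => Fintype.sum_sum_type _

/-- [folklore] **FULL MASS FROM BLOCK MASSES**: summable block masses `≤ B j i` give a summable full mass `≤ (B tt + B tf) + (B ft + B ff)`. -/
theorem fibreMass_le_of_blk {W : MKer 4 (Fib 3)} {B : Bool → Bool → ℝ}
    (h : ∀ j i : Bool, (Summable fun q : Site 4 × Site 4 => ∑ g, ∑ f, |blk W j i q.1 q.2 g f|) ∧
      ∑' q : Site 4 × Site 4, ∑ g, ∑ f, |blk W j i q.1 q.2 g f| ≤ B j i) :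
    (Summable fun q : Site 4 × Site 4 => ∑ g, ∑ a, |W q.1 q.2 g a|) ∧
      ∑' q : Site 4 × Site 4, ∑ g, ∑ a, |W q.1 q.2 g a| ≤ (B true true + B true false) + (B false true + B false false) := by
  have e : (fun q : Site 4 × Site 4 => ∑ g, ∑ a, |W q.1 q.2 g a|)
      = fun q => ((∑ g, ∑ f, |blk W true true q.1 q.2 g f|) + ∑ g, ∑ f, |blk W true false q.1 q.2 g f|)
        + ((∑ g, ∑ f, |blk W false true q.1 q.2 g f|) + ∑ g, ∑ f, |blk W false false q.1 q.2 g f|) :=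
    funext (fibreMass_eq_sum_blk W)
  rw [e]
  have htt := h true true
  have htf := h true false
  have hft := h false true
  have hff := h false false
  refine ⟨(htt.1.add htf.1).add (hft.1.add hff.1), ?_⟩
  rw [(htt.1.add htf.1).tsum_add (hft.1.add hff.1), htt.1.tsum_add htf.1, hft.1.tsum_add hff.1]
  exact add_le_add (add_le_add htt.2 htf.2) (add_le_add hft.2 hff.2)

/-! ## §2 The straight mixed pair + its swap: full mass -/

section Straight

variable (n : ℕ) [NeZero n]

/-- [folklore] **THE FULL `ℓ¹` MASS OF THE STRAIGHT MIXED PAIR WORD + SWAP** (modulo `hΦ` and a `LocStencilFM n M₂ C δ` table letter, `0 < δ`): summable, and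
`Σ'_q Σ_{g a} |(mixOfK K₀ n M₂ μ y ν y′ + mixOfK K₀ n M₂ ν y′ μ y) q g a| ≤ 8·C^{mix}_{K₀}·e^{−r|y′ − y|₁}` — g61 C′ per block for both words (`|y − y′|₁ = |y′ − y|₁`),
`plainMass_blk_add_le`, then §1 over the four blocks. -/
theorem fibreMass_restPair_K₀_le {CΦ κ₀ : ℝ} (hκ₀ : 0 < κ₀)
    (hΦ : ∀ (ρ ν : Fin (3 + 1)) (w : Fin (3 + 1) → ℤ),
      |wΦ (N := n) ρ ν w| ≤ CΦ * ((n : ℝ) ^ 5)⁻¹ * ((n : ℝ) ^ 3)⁻¹ * Real.exp (-(κ₀ * supNorm w)))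
    {M₂ : Fin (3 + 1) → (Fin (3 + 1) → ℤ) → Fin (3 + 1) → (Fin (3 + 1) → ℤ) → MKer 4 (Fib 3)} {C δ : ℝ}
    (hM : LocStencilFM n M₂ C δ) (hδ : 0 < δ) (μ : Fin (3 + 1)) (y : Fin (3 + 1) → ℤ) (ν : Fin (3 + 1)) (y' : Fin (3 + 1) → ℤ) :
    (Summable fun q : Site 4 × Site 4 => ∑ g, ∑ a,
        |(mixOfK (KInvStep (d := 3) n 0) n M₂ μ y ν y' + mixOfK (KInvStep (d := 3) n 0) n M₂ ν y' μ y) q.1 q.2 g a|) ∧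
      ∑' q : Site 4 × Site 4, ∑ g, ∑ a,
          |(mixOfK (KInvStep (d := 3) n 0) n M₂ μ y ν y' + mixOfK (KInvStep (d := 3) n 0) n M₂ ν y' μ y) q.1 q.2 g a|
        ≤ 8 * ((((n : ℝ) ^ 5)⁻¹ * (((n : ℝ) ^ 5)⁻¹ * ((n : ℝ) ^ 3)⁻¹))
            * (16 * ((MG163 4 * periodConst (kappa163 4) 3) * Real.exp (kappa163 4 / 4)) * (CΦ * Real.exp κ₀)
                * Real.exp (min (kappa163 4 / 4) κ₀) * Real.exp (min (kappa163 4 / 4) κ₀)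
                * Zl 4 (min (kappa163 4 / 4) κ₀ / 8) * Zl 4 (δ / 2))
            * ((n : ℝ) ^ 4 * (16 * C * Zl 4 (δ / 2) ^ 2 * Real.exp (4 * δ))))
          * Real.exp (-(min (min (kappa163 4 / 4) κ₀ / 8) (δ / 2)) * l1 (y' - y)) := by
  set K : ℝ := (((n : ℝ) ^ 5)⁻¹ * (((n : ℝ) ^ 5)⁻¹ * ((n : ℝ) ^ 3)⁻¹))
      * (16 * ((MG163 4 * periodConst (kappa163 4) 3) * Real.exp (kappa163 4 / 4)) * (CΦ * Real.exp κ₀)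
          * Real.exp (min (kappa163 4 / 4) κ₀) * Real.exp (min (kappa163 4 / 4) κ₀)
          * Zl 4 (min (kappa163 4 / 4) κ₀ / 8) * Zl 4 (δ / 2))
      * ((n : ℝ) ^ 4 * (16 * C * Zl 4 (δ / 2) ^ 2 * Real.exp (4 * δ))) with hK
  set r : ℝ := min (min (kappa163 4 / 4) κ₀ / 8) (δ / 2) with hr
  -- the two words, block by block
  have hA := fun j i => mass_blk_mixOfK_K₀_le_of_locStencilFM n hκ₀ hΦ hM hδ μ y ν y' j i
  have hB : ∀ j i : Bool,
      (Summable fun q : Site 4 × Site 4 => ∑ g, ∑ f, |blk (mixOfK (KInvStep (d := 3) n 0) n M₂ ν y' μ y) j i q.1 q.2 g f|) ∧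
        ∑' q : Site 4 × Site 4, ∑ g, ∑ f, |blk (mixOfK (KInvStep (d := 3) n 0) n M₂ ν y' μ y) j i q.1 q.2 g f|
          ≤ K * Real.exp (-r * l1 (y' - y)) := by
    intro j i
    have h := mass_blk_mixOfK_K₀_le_of_locStencilFM n hκ₀ hΦ hM hδ ν y' μ y j i
    rw [ExpKernelCalculus.l1_sub_symm y y'] at h
    exact h
  have hblk : ∀ j i : Bool,
      (Summable fun q : Site 4 × Site 4 => ∑ g, ∑ f,
        |blk (mixOfK (KInvStep (d := 3) n 0) n M₂ μ y ν y' + mixOfK (KInvStep (d := 3) n 0) n M₂ ν y' μ y) j i q.1 q.2 g f|) ∧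
        ∑' q : Site 4 × Site 4, ∑ g, ∑ f,
            |blk (mixOfK (KInvStep (d := 3) n 0) n M₂ μ y ν y' + mixOfK (KInvStep (d := 3) n 0) n M₂ ν y' μ y) j i q.1 q.2 g f|
          ≤ K * Real.exp (-r * l1 (y' - y)) + K * Real.exp (-r * l1 (y' - y)) :=
    fun j i => plainMass_blk_add_le j i (hA j i) (hB j i)
  have h := fibreMass_le_of_blk (B := fun _ _ => K * Real.exp (-r * l1 (y' - y)) + K * Real.exp (-r * l1 (y' - y))) hblk
  refine ⟨h.1, h.2.trans (le_of_eq ?_)⟩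
  ring

/-! ## §3 The (rest) row in `Decay510` ∕ (1.22) currency, any bounded leg -/

/-- [folklore] **THE (rest) WORD AGAINST A BOUNDED LEG IS A (5.10)-KERNEL** (modulo `Bdd G S`, `0 ≤ S`, `hΦ`, `LocStencilFM n M₂ C δ`, `0 < δ`):
`Decay510 (z ↦ ½·tadpole G (mixOfK K₀ n M₂ μ 0 ν z + mixOfK K₀ n M₂ ν z μ 0)) (½·(S·(8·C^{mix}_{K₀}))) r` — d1-leaf-04's `decay510_tadpoleWord_of_mass` over §2 at `y := 0`, `y′ := z`. -/
theorem decay510_restWord_K₀ {G : MKer 4 (Fib 3)} {S : ℝ} (hG : Bdd G S) (hS : 0 ≤ S) {CΦ κ₀ : ℝ} (hκ₀ : 0 < κ₀)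
    (hΦ : ∀ (ρ ν : Fin (3 + 1)) (w : Fin (3 + 1) → ℤ),
      |wΦ (N := n) ρ ν w| ≤ CΦ * ((n : ℝ) ^ 5)⁻¹ * ((n : ℝ) ^ 3)⁻¹ * Real.exp (-(κ₀ * supNorm w)))
    {M₂ : Fin (3 + 1) → (Fin (3 + 1) → ℤ) → Fin (3 + 1) → (Fin (3 + 1) → ℤ) → MKer 4 (Fib 3)} {C δ : ℝ}
    (hM : LocStencilFM n M₂ C δ) (hδ : 0 < δ) (μ ν : Fin (3 + 1)) :
    Decay510 (fun z : Site 4 => (1 / 2 : ℝ) * tadpole G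
        (mixOfK (KInvStep (d := 3) n 0) n M₂ μ 0 ν z + mixOfK (KInvStep (d := 3) n 0) n M₂ ν z μ 0))
      ((1 / 2 : ℝ) * (S * (8 * ((((n : ℝ) ^ 5)⁻¹ * (((n : ℝ) ^ 5)⁻¹ * ((n : ℝ) ^ 3)⁻¹))
            * (16 * ((MG163 4 * periodConst (kappa163 4) 3) * Real.exp (kappa163 4 / 4)) * (CΦ * Real.exp κ₀)
                * Real.exp (min (kappa163 4 / 4) κ₀) * Real.exp (min (kappa163 4 / 4) κ₀)
                * Zl 4 (min (kappa163 4 / 4) κ₀ / 8) * Zl 4 (δ / 2))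
            * ((n : ℝ) ^ 4 * (16 * C * Zl 4 (δ / 2) ^ 2 * Real.exp (4 * δ)))))))
      (min (min (kappa163 4 / 4) κ₀ / 8) (δ / 2)) := by
  -- the symmetrised family and its mass letter at the coarse origin
  have hmass := fun z : Site 4 => fibreMass_restPair_K₀_le n hκ₀ hΦ hM hδ μ 0 ν z
  have hd := decay510_tadpoleWord_of_mass (L := G)
    (𝒲 := fun μ' y ν' y' => mixOfK (KInvStep (d := 3) n 0) n M₂ μ' y ν' y' + mixOfK (KInvStep (d := 3) n 0) n M₂ ν' y' μ' y)
    hG hS μ ν (fun z => (hmass z).1) (fun z => by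
      have h := (hmass z).2
      rw [sub_zero] at h
      exact h)
  intro z
  have h := hd z
  rw [abs_mul, abs_of_pos (by norm_num : (0 : ℝ) < 1 / 2)]
  calc (1 / 2 : ℝ) * |tadpole G (mixOfK (KInvStep (d := 3) n 0) n M₂ μ 0 ν z + mixOfK (KInvStep (d := 3) n 0) n M₂ ν z μ 0)|
      ≤ (1 / 2 : ℝ) * (S * (8 * ((((n : ℝ) ^ 5)⁻¹ * (((n : ℝ) ^ 5)⁻¹ * ((n : ℝ) ^ 3)⁻¹))
            * (16 * ((MG163 4 * periodConst (kappa163 4) 3) * Real.exp (kappa163 4 / 4)) * (CΦ * Real.exp κ₀)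
                * Real.exp (min (kappa163 4 / 4) κ₀) * Real.exp (min (kappa163 4 / 4) κ₀)
                * Zl 4 (min (kappa163 4 / 4) κ₀ / 8) * Zl 4 (δ / 2))
            * ((n : ℝ) ^ 4 * (16 * C * Zl 4 (δ / 2) ^ 2 * Real.exp (4 * δ)))))
          * Real.exp (-(min (min (kappa163 4 / 4) κ₀ / 8) (δ / 2)) * l1 z)) :=
        mul_le_mul_of_nonneg_left h (by norm_num)
    _ = _ := by ring

/-- [folklore] **THE (rest) ROW IN THE HEAD's BINDER SHAPES** (`ChartDefectHead`'s `hArest` ∕ `hBrest` after `ChartDefectTwoPinsRest` (i); modulo `Bdd G S`, `0 ≤ S`, `hΦ`,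
`LocStencilFM n M₂ C δ`, `0 < δ`): for the kernel `Wrest a e z := ½·tadpole G (mixOfK K₀ n M₂ a 0 e z + mixOfK K₀ n M₂ e z a 0)`, (i) `∀ a e, AbsMoment₂ (Wrest a e)`;
(ii) `|secondMoment Wrest μ ν| ≤ ½·(S·(8·C^{mix}_{K₀}))·Σ'_x |x|₁² e^{−r|x|₁}` — lit (1.22) read-out of §3.  NET `n⁻⁹ × S × C`; the `n`-law of `S` is NOT claimed. -/
theorem restRow_K₀ {G : MKer 4 (Fib 3)} {S : ℝ} (hG : Bdd G S) (hS : 0 ≤ S) {CΦ κ₀ : ℝ} (hκ₀ : 0 < κ₀)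
    (hΦ : ∀ (ρ ν : Fin (3 + 1)) (w : Fin (3 + 1) → ℤ),
      |wΦ (N := n) ρ ν w| ≤ CΦ * ((n : ℝ) ^ 5)⁻¹ * ((n : ℝ) ^ 3)⁻¹ * Real.exp (-(κ₀ * supNorm w)))
    {M₂ : Fin (3 + 1) → (Fin (3 + 1) → ℤ) → Fin (3 + 1) → (Fin (3 + 1) → ℤ) → MKer 4 (Fib 3)} {C δ : ℝ}
    (hM : LocStencilFM n M₂ C δ) (hδ : 0 < δ) (μ ν : Fin (3 + 1)) :
    (∀ a e : Fin (3 + 1), AbsMoment₂ (fun z : Site 4 => (1 / 2 : ℝ) * tadpole G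
        (mixOfK (KInvStep (d := 3) n 0) n M₂ a 0 e z + mixOfK (KInvStep (d := 3) n 0) n M₂ e z a 0))) ∧
      |B12Beta.secondMoment (fun (a e : Fin (3 + 1)) (z : Site 4) => (1 / 2 : ℝ) * tadpole G
          (mixOfK (KInvStep (d := 3) n 0) n M₂ a 0 e z + mixOfK (KInvStep (d := 3) n 0) n M₂ e z a 0)) μ ν|
        ≤ ((1 / 2 : ℝ) * (S * (8 * ((((n : ℝ) ^ 5)⁻¹ * (((n : ℝ) ^ 5)⁻¹ * ((n : ℝ) ^ 3)⁻¹))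
            * (16 * ((MG163 4 * periodConst (kappa163 4) 3) * Real.exp (kappa163 4 / 4)) * (CΦ * Real.exp κ₀)
                * Real.exp (min (kappa163 4 / 4) κ₀) * Real.exp (min (kappa163 4 / 4) κ₀)
                * Zl 4 (min (kappa163 4 / 4) κ₀ / 8) * Zl 4 (δ / 2))
            * ((n : ℝ) ^ 4 * (16 * C * Zl 4 (δ / 2) ^ 2 * Real.exp (4 * δ)))))))
          * ∑' x : Site 4, l1 x ^ 2 * Real.exp (-(min (min (kappa163 4 / 4) κ₀ / 8) (δ / 2)) * l1 x) := by
  have hr : 0 < min (min (kappa163 4 / 4) κ₀ / 8) (δ / 2) :=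
    lt_min (by have := kappa163_pos 4; positivity) (half_pos hδ)
  have hd := fun a e => decay510_restWord_K₀ n hG hS hκ₀ hΦ hM hδ a e
  refine ⟨fun a e => absMoment₂_of_decay510 hr (hd a e), ?_⟩
  exact (secondMoment_abs_le_of_decay510
    (P := fun (a e : Fin (3 + 1)) (z : Site 4) => (1 / 2 : ℝ) * tadpole G
      (mixOfK (KInvStep (d := 3) n 0) n M₂ a 0 e z + mixOfK (KInvStep (d := 3) n 0) n M₂ e z a 0)) hr (hd μ ν)).2

/-! ## §4 At the record: an1's mixed table `M₂⁰ = M2Of 3 n (symTablesAn1S2 3 n cΛ).mixFF 0` -/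

/-- [folklore] **THE RECORD's MIXED TABLE IS `LocStencilFM` AT EVERY RATE, CONSTANT DISPLAYED** (`0 ≤ δ`): `LocStencilFM n (M2Of 3 n (symTablesAn1S2 3 n cΛ).mixFF 0)
(|wM2 3 n 0|·(symMixAbs ρ_c n·e^{6·4·n·δ})) δ` — an1's (Lmix) `biLoc_symMixFFAt` at the centred root through lit `locStencilFM_M2Of`. -/
theorem locStencilFM_M2_record (cΛ : ℝ) {δ : ℝ} (hδ : 0 ≤ δ) :
    LocStencilFM n (M2Of 3 n (symTablesAn1S2 3 n cΛ).mixFF 0)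
      (|wM2 3 n 0| * (symMixAbs (ctr 4 n) n * Real.exp (6 * ((3 : ℝ) + 1) * n * δ))) δ := by
  have hn : 1 ≤ n := Nat.one_le_iff_ne_zero.2 (NeZero.ne n)
  have h : LocStencilFM n (symTablesAn1S2 3 n cΛ).mixFF (symMixAbs (ctr 4 n) n * Real.exp (6 * ((3 : ℝ) + 1) * n * δ)) δ :=
    fun κ u μ y => biLoc_symMixFFAt (d := 3) hn (ctrOff_mem_box hn) hδ κ u μ y
  exact locStencilFM_M2Of h 0

/-- [folklore] **THE (rest) ROW AT THE RECORD** (modulo the displayed leg letter `Bdd G S`, `0 ≤ S`, and `hΦ`; `0 < δ` free): the binder shapes of `restRow_K₀` for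
`M₂ := M2Of 3 n (symTablesAn1S2 3 n cΛ).mixFF 0` with an1's table letter `locStencilFM_M2_record` plugged — the table side HYPOTHESIS-FREE (constant `symMixAbs ρ_c n` symbolic). -/
theorem restRow_record {G : MKer 4 (Fib 3)} {S : ℝ} (hG : Bdd G S) (hS : 0 ≤ S) {CΦ κ₀ : ℝ} (hκ₀ : 0 < κ₀)
    (hΦ : ∀ (ρ ν : Fin (3 + 1)) (w : Fin (3 + 1) → ℤ),
      |wΦ (N := n) ρ ν w| ≤ CΦ * ((n : ℝ) ^ 5)⁻¹ * ((n : ℝ) ^ 3)⁻¹ * Real.exp (-(κ₀ * supNorm w)))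
    (cΛ : ℝ) {δ : ℝ} (hδ : 0 < δ) (μ ν : Fin (3 + 1)) :
    (∀ a e : Fin (3 + 1), AbsMoment₂ (fun z : Site 4 => (1 / 2 : ℝ) * tadpole G
        (mixOfK (KInvStep (d := 3) n 0) n (M2Of 3 n (symTablesAn1S2 3 n cΛ).mixFF 0) a 0 e z
          + mixOfK (KInvStep (d := 3) n 0) n (M2Of 3 n (symTablesAn1S2 3 n cΛ).mixFF 0) e z a 0))) ∧
      |B12Beta.secondMoment (fun (a e : Fin (3 + 1)) (z : Site 4) => (1 / 2 : ℝ) * tadpole G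
          (mixOfK (KInvStep (d := 3) n 0) n (M2Of 3 n (symTablesAn1S2 3 n cΛ).mixFF 0) a 0 e z
            + mixOfK (KInvStep (d := 3) n 0) n (M2Of 3 n (symTablesAn1S2 3 n cΛ).mixFF 0) e z a 0)) μ ν|
        ≤ ((1 / 2 : ℝ) * (S * (8 * ((((n : ℝ) ^ 5)⁻¹ * (((n : ℝ) ^ 5)⁻¹ * ((n : ℝ) ^ 3)⁻¹))
            * (16 * ((MG163 4 * periodConst (kappa163 4) 3) * Real.exp (kappa163 4 / 4)) * (CΦ * Real.exp κ₀)
                * Real.exp (min (kappa163 4 / 4) κ₀) * Real.exp (min (kappa163 4 / 4) κ₀)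
                * Zl 4 (min (kappa163 4 / 4) κ₀ / 8) * Zl 4 (δ / 2))
            * ((n : ℝ) ^ 4 * (16 * (|wM2 3 n 0| * (symMixAbs (ctr 4 n) n * Real.exp (6 * ((3 : ℝ) + 1) * n * δ)))
                * Zl 4 (δ / 2) ^ 2 * Real.exp (4 * δ)))))))
          * ∑' x : Site 4, l1 x ^ 2 * Real.exp (-(min (min (kappa163 4 / 4) κ₀ / 8) (δ / 2)) * l1 x) :=
  restRow_K₀ n hG hS hκ₀ hΦ (locStencilFM_M2_record n cΛ hδ.le) hδ μ ν

/-! ## §5 The same row with the TABLE's COUNT FREE (R-T's reading: fine-block × coarse-slot totals `T j i` at coarse rate `θ`, the table author's letter) -/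

/-- [folklore] **FULL MASS OF THE STRAIGHT MIXED PAIR + SWAP, TABLE COUNT DISPLAYED** (g61 C′ `mass_blk_mixOfK_K₀_le` per block for both words, `plainMass_blk_add_le`, §1):
`≤ 2·K^{mix}_{K₀}(θ)·((T tt + T tf) + (T ft + T ff))·e^{−min (m₀∕8) (θ∕2)|y′ − y|₁}`, `K^{mix}_{K₀}(θ) = (n⁵)⁻¹·((n⁵)⁻¹·(n³)⁻¹)·(16·C₄e^{κ′}·CΦe^{κ₀}·e^{m₀}·e^{m₀}·Zl 4 (m₀∕8)·Zl 4 (θ∕2))` —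
the two straight columns pay exactly `n⁻¹³`, nothing of the table is priced here. -/
theorem fibreMass_restPair_K₀_le_of_blockSlotTotal {CΦ κ₀ : ℝ} (hκ₀ : 0 < κ₀)
    (hΦ : ∀ (ρ ν : Fin (3 + 1)) (w : Fin (3 + 1) → ℤ),
      |wΦ (N := n) ρ ν w| ≤ CΦ * ((n : ℝ) ^ 5)⁻¹ * ((n : ℝ) ^ 3)⁻¹ * Real.exp (-(κ₀ * supNorm w)))
    {M₂ : Fin (3 + 1) → (Fin (3 + 1) → ℤ) → Fin (3 + 1) → (Fin (3 + 1) → ℤ) → MKer 4 (Fib 3)} {θ : ℝ} {T : Bool → Bool → ℝ} (hθ : 0 < θ)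
    (hPs : ∀ κ u ρ' w j i, Summable fun p : Site 4 × Site 4 => ∑ g, ∑ f, |blk (M₂ κ u ρ' w) j i p.1 p.2 g f|)
    (hPB : ∀ (κ ρ' : Fin (3 + 1)) (y₁ w : Fin (3 + 1) → ℤ) (j i : Bool), ∑ b ∈ AffineAveraging.box (3 + 1) n,
      (∑' p : Site 4 × Site 4, ∑ g, ∑ f, |blk (M₂ κ ((n : ℤ) • y₁ + AffineAveraging.toSite b) ρ' w) j i p.1 p.2 g f|)
        ≤ T j i * Real.exp (-θ * l1 (w - y₁)))
    (μ : Fin (3 + 1)) (y : Fin (3 + 1) → ℤ) (ν : Fin (3 + 1)) (y' : Fin (3 + 1) → ℤ) :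
    (Summable fun q : Site 4 × Site 4 => ∑ g, ∑ a,
        |(mixOfK (KInvStep (d := 3) n 0) n M₂ μ y ν y' + mixOfK (KInvStep (d := 3) n 0) n M₂ ν y' μ y) q.1 q.2 g a|) ∧
      ∑' q : Site 4 × Site 4, ∑ g, ∑ a,
          |(mixOfK (KInvStep (d := 3) n 0) n M₂ μ y ν y' + mixOfK (KInvStep (d := 3) n 0) n M₂ ν y' μ y) q.1 q.2 g a|
        ≤ 2 * ((((n : ℝ) ^ 5)⁻¹ * (((n : ℝ) ^ 5)⁻¹ * ((n : ℝ) ^ 3)⁻¹))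
            * (16 * ((MG163 4 * periodConst (kappa163 4) 3) * Real.exp (kappa163 4 / 4)) * (CΦ * Real.exp κ₀)
                * Real.exp (min (kappa163 4 / 4) κ₀) * Real.exp (min (kappa163 4 / 4) κ₀)
                * Zl 4 (min (kappa163 4 / 4) κ₀ / 8) * Zl 4 (θ / 2)))
          * ((T true true + T true false) + (T false true + T false false))
          * Real.exp (-(min (min (kappa163 4 / 4) κ₀ / 8) (θ / 2)) * l1 (y' - y)) := by
  set K : ℝ := (((n : ℝ) ^ 5)⁻¹ * (((n : ℝ) ^ 5)⁻¹ * ((n : ℝ) ^ 3)⁻¹))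
      * (16 * ((MG163 4 * periodConst (kappa163 4) 3) * Real.exp (kappa163 4 / 4)) * (CΦ * Real.exp κ₀)
          * Real.exp (min (kappa163 4 / 4) κ₀) * Real.exp (min (kappa163 4 / 4) κ₀)
          * Zl 4 (min (kappa163 4 / 4) κ₀ / 8) * Zl 4 (θ / 2)) with hK
  set r : ℝ := min (min (kappa163 4 / 4) κ₀ / 8) (θ / 2) with hr
  have hA := fun j i => mass_blk_mixOfK_K₀_le n hκ₀ hΦ hθ hPs hPB μ y ν y' j i
  have hB : ∀ j i : Bool,
      (Summable fun q : Site 4 × Site 4 => ∑ g, ∑ f, |blk (mixOfK (KInvStep (d := 3) n 0) n M₂ ν y' μ y) j i q.1 q.2 g f|) ∧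
        ∑' q : Site 4 × Site 4, ∑ g, ∑ f, |blk (mixOfK (KInvStep (d := 3) n 0) n M₂ ν y' μ y) j i q.1 q.2 g f|
          ≤ K * T j i * Real.exp (-r * l1 (y' - y)) := by
    intro j i
    have h := mass_blk_mixOfK_K₀_le n hκ₀ hΦ hθ hPs hPB ν y' μ y j i
    rw [ExpKernelCalculus.l1_sub_symm y y'] at h
    exact h
  have hblk : ∀ j i : Bool,
      (Summable fun q : Site 4 × Site 4 => ∑ g, ∑ f,
        |blk (mixOfK (KInvStep (d := 3) n 0) n M₂ μ y ν y' + mixOfK (KInvStep (d := 3) n 0) n M₂ ν y' μ y) j i q.1 q.2 g f|) ∧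
        ∑' q : Site 4 × Site 4, ∑ g, ∑ f,
            |blk (mixOfK (KInvStep (d := 3) n 0) n M₂ μ y ν y' + mixOfK (KInvStep (d := 3) n 0) n M₂ ν y' μ y) j i q.1 q.2 g f|
          ≤ K * T j i * Real.exp (-r * l1 (y' - y)) + K * T j i * Real.exp (-r * l1 (y' - y)) :=
    fun j i => plainMass_blk_add_le j i (hA j i) (hB j i)
  have h := fibreMass_le_of_blk (B := fun j i => K * T j i * Real.exp (-r * l1 (y' - y)) + K * T j i * Real.exp (-r * l1 (y' - y))) hblk
  refine ⟨h.1, h.2.trans (le_of_eq ?_)⟩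
  ring

/-- [folklore] **THE (rest) ROW WITH THE TABLE's COUNT FREE, IN THE HEAD's BINDER SHAPES** (modulo `Bdd G S`, `0 ≤ S`, `hΦ`, the table author's per-slot-pair summabilities
`hPs` and fine-block × coarse-slot totals `hPB` with letters `T j i ≥ 0` implicitly through the bound, `0 < θ`): for `Wrest a e z := ½·tadpole G (mixOfK K₀ n M₂ a 0 e z +
mixOfK K₀ n M₂ e z a 0)`, (i) `∀ a e, AbsMoment₂ (Wrest a e)`; (ii) `|secondMoment Wrest μ ν| ≤ ½·(S·(2·K^{mix}_{K₀}(θ)·ΣT))·Σ'_x |x|₁² e^{−min (m₀∕8) (θ∕2)|x|₁}` — the two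
straight columns' `n⁻¹³` against the leg's sup and the table's own count. -/
theorem restRow_K₀_of_blockSlotTotal {G : MKer 4 (Fib 3)} {S : ℝ} (hG : Bdd G S) (hS : 0 ≤ S) {CΦ κ₀ : ℝ} (hκ₀ : 0 < κ₀)
    (hΦ : ∀ (ρ ν : Fin (3 + 1)) (w : Fin (3 + 1) → ℤ),
      |wΦ (N := n) ρ ν w| ≤ CΦ * ((n : ℝ) ^ 5)⁻¹ * ((n : ℝ) ^ 3)⁻¹ * Real.exp (-(κ₀ * supNorm w)))
    {M₂ : Fin (3 + 1) → (Fin (3 + 1) → ℤ) → Fin (3 + 1) → (Fin (3 + 1) → ℤ) → MKer 4 (Fib 3)} {θ : ℝ} {T : Bool → Bool → ℝ} (hθ : 0 < θ)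
    (hPs : ∀ κ u ρ' w j i, Summable fun p : Site 4 × Site 4 => ∑ g, ∑ f, |blk (M₂ κ u ρ' w) j i p.1 p.2 g f|)
    (hPB : ∀ (κ ρ' : Fin (3 + 1)) (y₁ w : Fin (3 + 1) → ℤ) (j i : Bool), ∑ b ∈ AffineAveraging.box (3 + 1) n,
      (∑' p : Site 4 × Site 4, ∑ g, ∑ f, |blk (M₂ κ ((n : ℤ) • y₁ + AffineAveraging.toSite b) ρ' w) j i p.1 p.2 g f|)
        ≤ T j i * Real.exp (-θ * l1 (w - y₁)))
    (μ ν : Fin (3 + 1)) :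
    (∀ a e : Fin (3 + 1), AbsMoment₂ (fun z : Site 4 => (1 / 2 : ℝ) * tadpole G
        (mixOfK (KInvStep (d := 3) n 0) n M₂ a 0 e z + mixOfK (KInvStep (d := 3) n 0) n M₂ e z a 0))) ∧
      |B12Beta.secondMoment (fun (a e : Fin (3 + 1)) (z : Site 4) => (1 / 2 : ℝ) * tadpole G
          (mixOfK (KInvStep (d := 3) n 0) n M₂ a 0 e z + mixOfK (KInvStep (d := 3) n 0) n M₂ e z a 0)) μ ν|
        ≤ ((1 / 2 : ℝ) * (S * (2 * ((((n : ℝ) ^ 5)⁻¹ * (((n : ℝ) ^ 5)⁻¹ * ((n : ℝ) ^ 3)⁻¹))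
            * (16 * ((MG163 4 * periodConst (kappa163 4) 3) * Real.exp (kappa163 4 / 4)) * (CΦ * Real.exp κ₀)
                * Real.exp (min (kappa163 4 / 4) κ₀) * Real.exp (min (kappa163 4 / 4) κ₀)
                * Zl 4 (min (kappa163 4 / 4) κ₀ / 8) * Zl 4 (θ / 2)))
            * ((T true true + T true false) + (T false true + T false false)))))
          * ∑' x : Site 4, l1 x ^ 2 * Real.exp (-(min (min (kappa163 4 / 4) κ₀ / 8) (θ / 2)) * l1 x) := by
  have hr : 0 < min (min (kappa163 4 / 4) κ₀ / 8) (θ / 2) :=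
    lt_min (by have := kappa163_pos 4; positivity) (half_pos hθ)
  have hmass := fun (a e : Fin (3 + 1)) (z : Site 4) => fibreMass_restPair_K₀_le_of_blockSlotTotal n hκ₀ hΦ hθ hPs hPB a 0 e z
  have hd : ∀ a e : Fin (3 + 1), Decay510 (fun z : Site 4 => (1 / 2 : ℝ) * tadpole G
      (mixOfK (KInvStep (d := 3) n 0) n M₂ a 0 e z + mixOfK (KInvStep (d := 3) n 0) n M₂ e z a 0))
      ((1 / 2 : ℝ) * (S * (2 * ((((n : ℝ) ^ 5)⁻¹ * (((n : ℝ) ^ 5)⁻¹ * ((n : ℝ) ^ 3)⁻¹))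
            * (16 * ((MG163 4 * periodConst (kappa163 4) 3) * Real.exp (kappa163 4 / 4)) * (CΦ * Real.exp κ₀)
                * Real.exp (min (kappa163 4 / 4) κ₀) * Real.exp (min (kappa163 4 / 4) κ₀)
                * Zl 4 (min (kappa163 4 / 4) κ₀ / 8) * Zl 4 (θ / 2)))
            * ((T true true + T true false) + (T false true + T false false)))))
      (min (min (kappa163 4 / 4) κ₀ / 8) (θ / 2)) := by
    intro a e
    have hda := decay510_tadpoleWord_of_mass (L := G)
      (𝒲 := fun μ' y ν' y' => mixOfK (KInvStep (d := 3) n 0) n M₂ μ' y ν' y' + mixOfK (KInvStep (d := 3) n 0) n M₂ ν' y' μ' y)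
      hG hS a e (fun z => (hmass a e z).1) (fun z => by
        have h := (hmass a e z).2
        rw [sub_zero] at h
        exact h)
    intro z
    have h := hda z
    rw [abs_mul, abs_of_pos (by norm_num : (0 : ℝ) < 1 / 2)]
    calc (1 / 2 : ℝ) * |tadpole G (mixOfK (KInvStep (d := 3) n 0) n M₂ a 0 e z + mixOfK (KInvStep (d := 3) n 0) n M₂ e z a 0)|
        ≤ (1 / 2 : ℝ) * (S * (2 * ((((n : ℝ) ^ 5)⁻¹ * (((n : ℝ) ^ 5)⁻¹ * ((n : ℝ) ^ 3)⁻¹))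
              * (16 * ((MG163 4 * periodConst (kappa163 4) 3) * Real.exp (kappa163 4 / 4)) * (CΦ * Real.exp κ₀)
                  * Real.exp (min (kappa163 4 / 4) κ₀) * Real.exp (min (kappa163 4 / 4) κ₀)
                  * Zl 4 (min (kappa163 4 / 4) κ₀ / 8) * Zl 4 (θ / 2)))
              * ((T true true + T true false) + (T false true + T false false)))
            * Real.exp (-(min (min (kappa163 4 / 4) κ₀ / 8) (θ / 2)) * l1 z)) :=
          mul_le_mul_of_nonneg_left h (by norm_num)
      _ = _ := by ring
  refine ⟨fun a e => absMoment₂_of_decay510 hr (hd a e), ?_⟩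
  exact (secondMoment_abs_le_of_decay510
    (P := fun (a e : Fin (3 + 1)) (z : Site 4) => (1 / 2 : ℝ) * tadpole G
      (mixOfK (KInvStep (d := 3) n 0) n M₂ a 0 e z + mixOfK (KInvStep (d := 3) n 0) n M₂ e z a 0)) hr (hd μ ν)).2

end Straight

end Summit.QuantumFields.BalabanUV.Beta.D1BFx.StraightPinRestRow

end
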